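import Mathlib
import Summits.Ventures.PercRepro2.SwOutCrossGenSumIneqQ
import Summits.Ventures.PercRepro2.SwOutCrossJunctionSwGN
import Summits.Ventures.PercRepro2.SwOutCrossJunctionQSwG

/-!
# Any number of connected dropped components at one junction WITH THE MARK AT A DROPPED VERTEX
(blind cell PercRepro2, night-4 g27, 2026-08-28; proofs/NIGHT4-G27.md §3)

g25's nested disjoint union `sumX c l` of a list of connected components has the LAST component
of the list at its base (the innermost left summand).  With the mark at a vertex `q` of the base
component (`baseIn c l q`), the glued fibre `fibKEEQSumN` carries g26's link fields of the mark
at every stage — the base is `fibKEEQBit`, each further component is glued by `fibKEEQSum`, the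
mark staying in the first part — and its inequality follows by induction on the list
(`ineq_fibKEEQSumN`, from `ineq_ofBit` and `ineq_fibKEEQSum`).  Hence
`IneqAllQ (sumG c l) V (baseIn c l q)` (`ineqAllQ_sumN`) and **`sw_of_crossJunctionQN`**: row
(SW) on every graph with a junction whose dropped vertices form any finite number of connected
cross-edge components and whose mark is a dropped vertex of the base component — Theorem A_cross
with the mark at a dropped vertex for several components in one statement.  Since the components
may be listed in any order, the mark's component may always be taken as the base: that is
`SwOutCrossJunctionQAny`.
-/

namespace Summit.Ventures.PercRepro2

namespace CrossArm

open Hull LocRows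

universe u uV

section Base

/-- The base component of a nested sum of components: the last of the list. -/
def baseC : CompG.{u} → List CompG.{u} → CompG.{u}
  | c, [] => c
  | _, d :: l => baseC d l

/-- A vertex of the base component as a vertex of the nested sum (the innermost left summand). -/
def baseIn : ∀ (c : CompG.{u}) (l : List CompG.{u}), (baseC c l).X → sumX c l
  | _, [], x => x
  | _, d :: l, x => Sum.inl (baseIn d l x)

end Base

section Fibre

/-- A fibre with the link fields of the mark `q`, the proofs bundled. -/
def KEQFibre (X : Type u) (G : SimpleGraph X) (q : X) :=
  {F : FibreIter (FibKE X G) (AtomKEE X G) (LabelKEQ X) //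
    F.flip = FibKE.flip ∧ F.leakR = leakKE G ∧ F.label = labelKEQ G q ∧ F.BetterL = BetterKEQ ∧
      F.red = redKEE G}

open Classical in
/-- The glued fibre of a list of components with the mark at a vertex `q` of the base component,
with its link fields. -/
noncomputable def fibKEEQSumN : ∀ (c : CompG.{u}) (l : List CompG.{u}) (q : (baseC c l).X),
    KEQFibre (sumX c l) (sumG c l) (baseIn c l q)
  | c, [], q => ⟨FibreIter.ofBit (fibKEEQBit c.G c.hG q), rfl, rfl, rfl, rfl, rfl⟩
  | c, d :: l, q =>
    ⟨fibKEEQSum c.G (baseIn d l q) (fibKEEQSumN d l q).1 (fibKEEQSumN d l q).2.1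
        (fibKEEQSumN d l q).2.2.1 (fibKEEQSumN d l q).2.2.2.1 (fibKEEQSumN d l q).2.2.2.2.1
        (fibKEEQSumN d l q).2.2.2.2.2,
      rfl, rfl, rfl, rfl, rfl⟩

end Fibre

section Ineq

variable {ι : Type*} [Fintype ι] [DecidableEq ι] [Nonempty ι]

open Classical in
/-- **The glued fibre of a list of components with the mark at the base has the inequality**, by
induction on the list. -/
theorem ineq_fibKEEQSumN : ∀ (c : CompG.{u}) (l : List CompG.{u}) (q : (baseC c l).X),
    Ineq (fibKEEQSumN c l q).1 (ι := ι)
  | c, [], q => Ineq.congr_inst _ _ (ineq_ofBit (fibKEEQBit c.G c.hG q))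
  | c, d :: l, q =>
    Ineq.congr_inst _ _ (ineq_fibKEEQSum c.G c.hG (baseIn d l q) (fibKEEQSumN d l q).1
      (fibKEEQSumN d l q).2.1 (fibKEEQSumN d l q).2.2.1 (fibKEEQSumN d l q).2.2.2.1
      (fibKEEQSumN d l q).2.2.2.2.1 (fibKEEQSumN d l q).2.2.2.2.2
      (Ineq.congr_inst _ _ (ineq_fibKEEQSumN d l q)))

/-- The record of a `KEQFibre` is the link record of its mark. -/
lemma KEQFibre.toMin_eq {X : Type u} {G : SimpleGraph X} {q : X} (F : KEQFibre X G q) :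
    F.1.toMin = fibKEEQMin G q := by
  obtain ⟨F, h1, h2, h3, h4, h5⟩ := F
  simp only [FibreIter.toMin, fibKEEQMin, h1, h2, h3, h4, h5]

open Classical in
/-- **The link record of the nested sum of a list of components, with the mark at the base, has
the inequality.** -/
theorem ineqM_sumNQ (c : CompG.{u}) (l : List CompG.{u}) (q : (baseC c l).X) :
    IneqM (fibKEEQMin (sumG c l) (baseIn c l q)) (ι := ι) := by
  have h := ineqM_of_ineq _ (ineq_fibKEEQSumN (ι := ι) c l q)
  rwa [KEQFibre.toMin_eq] at h

end Ineq

section Junction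

variable {V : Type uV} {E : Type*} [Fintype E] [DecidableEq E]

open scoped Classical

variable (c : CompG.{u}) (l : List CompG.{u}) (q : (baseC c l).X) {ends : E → Sym2 V} {U : Set V}
  {l₀ h o u : V} {p : sumX c l → V}

/-- **The link record of any list of connected components, with the mark at the base, has the
inequality over every u-arm type.** -/
theorem ineqAllQ_sumN : IneqAllQ (sumG c l) V (baseIn c l q) := by
  intro S _ _ _ _ _
  exact IneqM.congr_inst _ _ (ineqM_sumNQ c l q (ι := {P // P ∈ S}))

/-- **THEOREM A_cross WITH THE MARK AT A DROPPED VERTEX FOR ANY NUMBER OF CONNECTED DROPPED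
COMPONENTS AT ONE JUNCTION** (the mark in the base component): the rigid inequality on every
class, for every outside colouring. -/
theorem CrossJunctionQ.rigidOK_of_crossJunctionQN
    (hj : CrossJunctionQ ends U h u p (sumG c l) o (baseIn c l q)) (hl : l₀ ∉ U) (ξ : Config E) :
    RigidOK ends l₀ h o U ξ :=
  hj.rigidOK_of_crossJunction' hl (ineqAllQ_sumN c l q)

/-- **Row 2′SW-ALL on every graph with a junction whose dropped vertices form any finite number
of connected cross-edge components and whose mark is a dropped vertex of the base component.** -/
theorem swAll_of_crossJunctionQN (hlh : l₀ ≠ h)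
    (hj : CrossJunctionQ ends ({l₀}ᶜ) h u p (sumG c l) o (baseIn c l q)) : SwAll ends l₀ h o :=
  swAll_of_crossJunctionQ' hlh hj (ineqAllQ_sumN c l q)

/-- **Row (SW) on every graph with a junction whose dropped vertices form any finite number of
connected cross-edge components and whose mark is a dropped vertex of the base component.** -/
theorem sw_of_crossJunctionQN (hlh : l₀ ≠ h)
    (hj : CrossJunctionQ ends ({l₀}ᶜ) h u p (sumG c l) o (baseIn c l q)) : Sw ends l₀ h o :=
  sw_of_crossJunctionQ' hlh hj (ineqAllQ_sumN c l q)

end Junction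

end CrossArm

end Summit.Ventures.PercRepro2
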